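import Mathlib
import Summits.KontsevichZagierPeriods.Zeta5Search.ThirdOrderTypes
import Summits.KontsevichZagierPeriods.Zeta5Search.SecondOrderCorr
import HarnessLib

/-!
# ζ(5) search — `v̂₂(1 :: T)` and the vanishing of its TRANSLATION TERM (tools for gen-2 g10's THEOREM A⁗, pair identity P1)

Cell `pub-zeta5` (HONEST FRAMING: systematic search; no irrationality claim unless certified), typer seat generation 12.
The second-order companion of `SecondOrderRaise.typeV_consOne` / `SecondOrderCorr.typeCorr_eq_zero_of_consClass` (typer g11):
* `typeCorr2 L e` — the translation term: the principal parts of `η'·Φ_{1::T}(η')` evaluated at the zero `η' = 0`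
  (`Σ_{poles} Σ_σ (−1)^σ (i'ρ'_{i',σ} + ρ'_{i',σ+1}) (i')^{−σ}`, `i' = i + 1`, `ρ'` the cofactor data of `1 :: T`);
* `typeV2_consOne` — **`v̂₂(1 :: T) = v̂₃(T) + 2v̂₂(T) + v̂(T) + corr₂(T)`** (REPORT-gen2-g10 §6.4: `σ[(η+1)²Φ_T]` after the shift `η' = η + 1`);
* `rhoK_one` — `ρ^{(1)}_{q,σ} = ℓ_q ρ_{q,σ} + ρ_{q,σ+1}`;
* `typeCorr2_eq_zero_of_consClass` — **`corr₂(T) = 0`** for a realised class of type `1 :: T` with exponent `< −1`: typer g9's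
  partial-fraction identity `classPF` at `k = 1`, evaluated at `X = 0` (where `X¹` vanishes).
Polynomial algebra over `ℚ`; nothing here bears on irrationality.
-/

noncomputable section

open Finset Polynomial

namespace Summit.KontsevichZagierPeriods.Zeta5Search.SecondOrder

open Summit.KontsevichZagierPeriods.Zeta5Search.ClusterValuation
open Summit.KontsevichZagierPeriods.Zeta5Search.LevelClass (typeRho typeW typeV typeExp classSet_level level_injective level_mem
  classPoles_level)
open Summit.KontsevichZagierPeriods.Zeta5Search.CellA (harm_succ)
open Literature.NumberTheory.Transcendental.BallRivoal (harm)

variable {p : ℕ} [hp : Fact p.Prime]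

/-- The TRANSLATION TERM of `v̂₂` under `T ↦ 1 :: T`: the principal parts of `η'Φ_{1::T}(η')` evaluated at `η' = 0`,
written with the cofactor data `ρ'` of `1 :: T` at the shifted levels `i' = i + 1`. -/
def typeCorr2 (L : ℕ) (e : ℕ → ℤ) : ℚ :=
  ∑ i ∈ (range (L + 1)).filter (fun i => e i < 0), ∑ σ ∈ Icc 1 (-e i).toNat,
    (-1 : ℚ) ^ σ * ((((i + 1 : ℕ) : ℕ) : ℚ) * typeRho (L + 1) (consOne e) (i + 1) σ
      + (if (σ : ℤ) + 1 ≤ -e i then typeRho (L + 1) (consOne e) (i + 1) (σ + 1) else 0)) * (1 / (((i : ℕ) : ℚ) + 1) ^ σ)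

omit hp in
/-- **`v̂₂(1 :: T) = v̂₃(T) + 2v̂₂(T) + v̂(T) + corr₂(T)`.** -/
theorem typeV2_consOne (L : ℕ) (e : ℕ → ℤ) :
    typeV2 (L + 1) (consOne e) = typeV3 L e + 2 * typeV2 L e + typeV L e + typeCorr2 L e := by
  unfold typeV typeV2 typeV3 typeCorr2
  rw [sum_filter, sum_filter, sum_filter, sum_filter, sum_filter, mul_sum, ← sum_add_distrib, ← sum_add_distrib,
    ← sum_add_distrib, sum_range_succ', show consOne e 0 = 1 by rw [consOne, if_pos rfl], if_neg (by norm_num), add_zero]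
  refine sum_congr rfl fun i hi => ?_
  have hiL : i ≤ L := by have := mem_range.1 hi; omega
  have hr : consOne e (i + 1) = e i := by rw [consOne, if_neg (by omega), Nat.add_sub_cancel]
  rw [hr]
  by_cases h0 : e i < 0
  · rw [if_pos h0, if_pos h0, if_pos h0, if_pos h0, if_pos h0, mul_sum, ← sum_add_distrib, ← sum_add_distrib, ← sum_add_distrib]
    refine sum_congr rfl fun σ hσ => ?_
    have hσ' := (mem_Icc.1 hσ)
    have hρ1 : (σ : ℤ) + 1 ≤ -e i → typeRho (L + 1) (consOne e) (i + 1) (σ + 1) =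
        (((i : ℕ) : ℚ) + 1) * typeRho L e i (σ + 1) + (if (σ : ℤ) + 2 ≤ -e i then typeRho L e i (σ + 2) else 0) := fun h => by
      rw [typeRho_consOne e i h]
      congr 1
    rw [harm_succ, typeRho_consOne e i (show (σ : ℤ) ≤ -e i by omega)]
    by_cases hs1 : (σ : ℤ) + 1 ≤ -e i
    · rw [hρ1 hs1]
      push_cast
      split_ifs <;> first | omega | ring
    · push_cast
      split_ifs <;> first | omega | ring
  · rw [if_neg h0, if_neg h0, if_neg h0, if_neg h0, if_neg h0]; ring

/-- `ρ^{(1)}_{q,σ} = ℓ_q ρ_{q,σ} + ρ_{q,σ+1}` (the last term absent at `σ = n_q`). -/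
theorem rhoK_one (b : ℕ → ℤ) (p q σ : ℕ) :
    rhoK b p q 1 σ = lvl p q * classRho b p q σ
      + (if (-netExp b q).toNat - σ = 0 then 0 else classRho b p q (σ + 1)) := by
  unfold rhoK classRho
  rw [pow_one, mul_comm, coeff_mul_X_add_C', show (-netExp b q).toNat - (σ + 1) = (-netExp b q).toNat - σ - 1 by omega]

/-- **`corr₂(T) = 0` for a realised class of type `1 :: T` with exponent `< −1`.** -/
theorem typeCorr2_eq_zero_of_consClass (b : ℕ → ℤ) {y L : ℕ} (hy : y < p) (hM : y + (L + 1) * p ≤ (b 0).toNat)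
    (hM' : (b 0).toNat < y + (L + 1) * p + p) (e : ℕ → ℤ) (he : ∀ i ≤ L + 1, netExp b (y + i * p) = consOne e i)
    (hc0 : ¬ (¬ (2 : ℤ) ∣ b 0 ∧ CentreIn b p y)) (hneg : classExp b p y < -1) : typeCorr2 L e = 0 := by
  have hp0 : 0 < p := hp.out.pos
  -- the partial-fraction identity at `k = 1`, evaluated at `X = 0`
  have hdeg : degN b p y + 1 < degD b p y := by
    have := classExp_eq_degN_sub_degD b p y; omega
  have hPF := classPF b hp0 1 hdeg
  have hev := congrArg (Polynomial.eval 0) hPF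
  rw [pow_one, Polynomial.eval_mul, Polynomial.eval_X, zero_mul] at hev
  simp only [Polynomial.eval_finsetSum, Polynomial.eval_mul, Polynomial.eval_C] at hev
  -- the poles of the class: levels `i + 1` with `e i < 0`
  have hP : classPoles b p y = ((range (L + 1 + 1)).filter fun k => consOne e k < 0).image fun k => y + k * p :=
    classPoles_level b hy hM hM' (consOne e) he
  have hlv : ∀ k, lvl p (y + k * p) = (k : ℚ) := fun k => by unfold lvl; rw [level_div hy]
  set D0 := (denPhi b p y).eval 0 with hD0
  have hk0_of : ∀ k, k ∈ (range (L + 1 + 1)).filter (fun k => consOne e k < 0) → k ≠ 0 := by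
    rintro k hk rfl
    have := (mem_filter.1 hk).2
    rw [consOne, if_pos rfl] at this; omega
  have hD0ne : D0 ≠ 0 := by
    rw [hD0, denPhi, Polynomial.eval_prod]
    refine prod_ne_zero_iff.2 fun q hq => ?_
    rw [hP] at hq
    obtain ⟨k, hk, rfl⟩ := mem_image.1 hq
    rw [Polynomial.eval_pow, Polynomial.eval_sub, Polynomial.eval_X, Polynomial.eval_C, hlv]
    exact pow_ne_zero _ (by rw [zero_sub, neg_ne_zero]; exact_mod_cast hk0_of k hk)
  have hpfM : ∀ q ∈ classPoles b p y, ∀ σ ∈ Icc 1 (-netExp b q).toNat,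
      (pfM b p y q σ).eval 0 = D0 * ((0 - lvl p q) ^ σ)⁻¹ := by
    intro q hq σ hσ
    have hσ' := (mem_Icc.1 hσ).2
    have hlq : lvl p q ≠ 0 := by
      rw [hP] at hq
      obtain ⟨k, hk, rfl⟩ := mem_image.1 hq
      rw [hlv]; exact_mod_cast hk0_of k hk
    have hD : D0 = (denOff b p y q).eval 0 * (0 - lvl p q) ^ (-netExp b q).toNat := by
      rw [hD0, denPhi_eq_denOff_mul b p y hq, Polynomial.eval_mul, Polynomial.eval_pow, Polynomial.eval_sub, Polynomial.eval_X,
        Polynomial.eval_C]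
    rw [pfM, Polynomial.eval_mul, Polynomial.eval_pow, Polynomial.eval_sub, Polynomial.eval_X, Polynomial.eval_C, hD]
    have hz : (0 - lvl p q) ≠ 0 := by rw [zero_sub, neg_ne_zero]; exact hlq
    rw [mul_assoc, ← pow_sub₀ _ hz hσ']
  have hsum : ∑ q ∈ classPoles b p y, ∑ σ ∈ Icc 1 (-netExp b q).toNat, rhoK b p q 1 σ * (pfM b p y q σ).eval 0 =
      D0 * ∑ q ∈ classPoles b p y, ∑ σ ∈ Icc 1 (-netExp b q).toNat, rhoK b p q 1 σ * ((0 - lvl p q) ^ σ)⁻¹ := by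
    rw [mul_sum]
    refine sum_congr rfl fun q hq => ?_
    rw [mul_sum]
    refine sum_congr rfl fun σ hσ => ?_
    rw [hpfM q hq σ hσ]; ring
  rw [hsum] at hev
  have hS : ∑ q ∈ classPoles b p y, ∑ σ ∈ Icc 1 (-netExp b q).toNat, rhoK b p q 1 σ * ((0 - lvl p q) ^ σ)⁻¹ = 0 := by
    rcases mul_eq_zero.1 hev.symm with h | h
    · exact absurd h hD0ne
    · exact h
  -- reindex over the levels `k = i + 1`
  rw [hP, sum_image (fun a _ c _ h => level_injective hp0 y h)] at hS
  rw [sum_filter, sum_range_succ', show consOne e 0 = 1 by rw [consOne, if_pos rfl], if_neg (by norm_num), add_zero] at hS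
  -- compare termwise with `typeCorr2`
  have hT : typeCorr2 L e = ∑ k ∈ range (L + 1), (if consOne e (k + 1) < 0 then
      ∑ σ ∈ Icc 1 (-netExp b (y + (k + 1) * p)).toNat,
        rhoK b p (y + (k + 1) * p) 1 σ * ((0 - lvl p (y + (k + 1) * p)) ^ σ)⁻¹ else 0) := by
    unfold typeCorr2
    rw [sum_filter]
    refine sum_congr rfl fun i hi => ?_
    have hiL : i ≤ L := by have := mem_range.1 hi; omega
    have hci : consOne e (i + 1) = e i := by rw [consOne, if_neg (by omega), Nat.add_sub_cancel]
    rw [hci]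
    by_cases h0 : e i < 0
    · rw [if_pos h0, if_pos h0, he (i + 1) (by omega), hci]
      refine sum_congr rfl fun σ hσ => ?_
      have hσ' := mem_Icc.1 hσ
      rw [rhoK_one, he (i + 1) (by omega), hci, classRho_level₀ b hy hM hM' (consOne e) he hc0 (by omega : i + 1 ≤ L + 1) σ, hlv]
      have hne : (((i : ℕ) : ℚ) + 1) ≠ 0 := by positivity
      have hρ' : (if (-e i).toNat - σ = 0 then (0 : ℚ) else classRho b p (y + (i + 1) * p) (σ + 1)) =
          (if (σ : ℤ) + 1 ≤ -e i then typeRho (L + 1) (consOne e) (i + 1) (σ + 1) else 0) := by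
        by_cases h1 : (σ : ℤ) + 1 ≤ -e i
        · rw [if_neg (by omega), if_pos h1, classRho_level₀ b hy hM hM' (consOne e) he hc0 (by omega : i + 1 ≤ L + 1) (σ + 1)]
        · rw [if_pos (by omega), if_neg h1]
      rw [hρ', show ((0 : ℚ) - ((i + 1 : ℕ) : ℚ)) = (-1) * ((((i : ℕ) : ℚ)) + 1) by push_cast; ring, mul_pow, mul_inv,
        ← inv_pow (-1 : ℚ), inv_neg_one]
      push_cast
      field_simp
    · rw [if_neg h0, if_neg h0]
  rw [hT]
  exact hS

end Summit.KontsevichZagierPeriods.Zeta5Search.SecondOrder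

end
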